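import Literature.Analysis.FluidPDE.IntegratedChainRule
import Mathlib.Analysis.Calculus.Deriv.Inv
import HarnessLib

/-!
# The Riccati differential inequality `y' ≤ −a y²` for absolutely continuous functions

Analysis/ODE proofs file (theorems only). In Nash's lower-bound argument the weighted
logarithmic mean `Ψ̄(t) = −∫ ζ² ln Φ(·, t)` of a positive solution satisfies, after the entropy
estimate and Nash's inequality, a differential inequality of Riccati type
(Lei–Zhang, J. Funct. Anal. 261 (2011) = arXiv:1011.5066, proof of Lemma 3.2, p. 10:
"`∂ₜΨ̄ + C₀Ψ̄ ≤ −(c₀²χ(s)/C₀) Ψ̄²` … Solving the above inequality gives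
`Ψ̄(−c₀/4) ≤ 1 / ((c₀²/C₀)∫χ(s)e^{−C₀s}ds + 1/Ψ̄(−1/4)) < ∞`"; Chen–Strain–Tsai–Yau 2009, §5.4).
Since `Ψ̄` is only absolutely continuous in time (the equation being available in
time-integrated form), the comparison argument is recorded here for absolutely continuous
functions:

* `inv_add_integral_le_inv_of_deriv_le` — if `y > 0` is absolutely continuous on `[t₀, t₁]` and
  `y' ≤ −a y²` a.e. with `a` integrable, then `1/y(t₀) + ∫_{t₀}^{t₁} a ≤ 1/y(t₁)`
  (`(1/y)' = −y'/y² ≥ a` a.e. and the fundamental theorem of calculus for the absolutely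
  continuous `1/y`); in particular `y(t₁) ≤ (∫_{t₀}^{t₁} a)⁻¹` when `∫ a > 0`
  (`le_inv_integral_of_deriv_le`).

The exponential weight of the printed inequality is absorbed by applying the lemma to
`w = e^{C₀t} y`, `a ↦ a e^{−C₀t}`.

## References

* Z. Lei, Q. S. Zhang, J. Funct. Anal. 261 (2011) = arXiv:1011.5066, proof of Lemma 3.2, p. 10.
  [LeiZhang2011]
* C.-C. Chen, R. M. Strain, T.-P. Tsai, H.-T. Yau, Comm. PDE 34 (2009), §5.4.
  [ChenStrainTsaiYau2009]
-/

noncomputable section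

open MeasureTheory Set Filter intervalIntegral
open scoped Topology NNReal

namespace Literature.Analysis.ODE

/-- **Riccati comparison for absolutely continuous functions.** Let `y` be absolutely
continuous and positive on `[t₀, t₁]`, `a` integrable on `[t₀, t₁]`, and `y' ≤ −a y²` at
a.e. point of `[t₀, t₁]` (where `y'` is the a.e. derivative). Then
`1/y(t₀) + ∫_{t₀}^{t₁} a ≤ 1/y(t₁)`: the function `1/y` is absolutely continuous (`y` is bounded
below by a positive constant on the compact interval and `v ↦ v⁻¹` is Lipschitz there) with
`(1/y)' = −y'/y² ≥ a` a.e., and the fundamental theorem of calculus applies (Lei–Zhang 2011,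
proof of Lemma 3.2: "Solving the above inequality gives …"). [cite: LeiZhang2011, proof of Lemma 3.2 (arXiv p. 10), the Riccati step] -/
theorem inv_add_integral_le_inv_of_deriv_le {y a : ℝ → ℝ} {t₀ t₁ : ℝ} (ht : t₀ ≤ t₁)
    (hy : AbsolutelyContinuousOnInterval y t₀ t₁) (hpos : ∀ t ∈ Icc t₀ t₁, 0 < y t)
    (ha : IntervalIntegrable a volume t₀ t₁)
    (hderiv : ∀ᵐ t, t ∈ Icc t₀ t₁ → deriv y t ≤ -(a t * y t ^ 2)) :
    1 / y t₀ + ∫ s in t₀..t₁, a s ≤ 1 / y t₁ := by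
  have hIcc : uIcc t₀ t₁ = Icc t₀ t₁ := uIcc_of_le ht
  -- a positive lower bound for `y` on the compact interval
  obtain ⟨δ, hδ, hyδ⟩ : ∃ δ : ℝ, 0 < δ ∧ ∀ t ∈ Icc t₀ t₁, δ ≤ y t := by
    have hcont : ContinuousOn y (Icc t₀ t₁) := hIcc ▸ hy.continuousOn
    obtain ⟨tm, htm, hmin⟩ := isCompact_Icc.exists_isMinOn (nonempty_Icc.2 ht) hcont
    exact ⟨y tm, hpos tm htm, fun t ht' => hmin ht'⟩
  obtain ⟨C, hC⟩ := hy.exists_bound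
  -- `v ↦ v⁻¹` is Lipschitz on `[δ, max C δ]`, which contains the range of `y`
  have hmaps : MapsTo y (uIcc t₀ t₁) (Icc δ (max C δ)) := by
    intro t ht'
    have htI : t ∈ Icc t₀ t₁ := hIcc ▸ ht'
    refine ⟨hyδ t htI, ?_⟩
    have h := hC t ht'
    rw [Real.norm_eq_abs, abs_of_pos (hpos t htI)] at h
    exact h.trans (le_max_left _ _)
  obtain ⟨K, hK⟩ : ∃ K, LipschitzOnWith K (fun v : ℝ => v⁻¹) (Icc δ (max C δ)) := by
    refine ⟨((δ ^ 2)⁻¹).toNNReal, LipschitzOnWith.of_dist_le_mul fun u hu v hv => ?_⟩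
    have hu0 : 0 < u := hδ.trans_le hu.1
    have hv0 : 0 < v := hδ.trans_le hv.1
    rw [Real.coe_toNNReal _ (by positivity), Real.dist_eq, Real.dist_eq,
      inv_sub_inv hu0.ne' hv0.ne', abs_div, abs_mul, abs_of_pos hu0, abs_of_pos hv0, abs_sub_comm]
    rw [div_le_iff₀ (mul_pos hu0 hv0)]
    have huv : δ ^ 2 ≤ u * v := by nlinarith [hu.1, hv.1]
    have h1 : |u - v| ≤ (δ ^ 2)⁻¹ * |u - v| * (u * v) := by
      have hnn := abs_nonneg (u - v)
      have : 1 ≤ (δ ^ 2)⁻¹ * (u * v) := by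
        rw [inv_mul_eq_div, le_div_iff₀ (by positivity)]
        linarith
      nlinarith
    linarith
  have hinvac : AbsolutelyContinuousOnInterval (fun t => (y t)⁻¹) t₀ t₁ :=
    hy.comp_of_lipschitzOnWith hK hmaps
  -- the fundamental theorem of calculus for `1/y`
  have hFTC := hinvac.integral_deriv_eq_sub
  -- `(1/y)' ≥ a` a.e. on the interval
  have hge : ∀ᵐ t, t ∈ uIoc t₀ t₁ → a t ≤ deriv (fun s => (y s)⁻¹) t := by
    filter_upwards [hy.ae_differentiableAt, hderiv] with t hdiff hder hmem
    have ht' : t ∈ uIcc t₀ t₁ := uIoc_subset_uIcc hmem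
    have htI : t ∈ Icc t₀ t₁ := hIcc ▸ ht'
    have hyt : 0 < y t := hpos t htI
    have hd : HasDerivAt (fun s => (y s)⁻¹) (-(deriv y t) / y t ^ 2) t :=
      (hdiff ht').hasDerivAt.inv hyt.ne'
    rw [hd.deriv]
    have h1 := hder htI
    rw [le_div_iff₀ (by positivity)]
    linarith
  have hmono : ∫ s in t₀..t₁, a s ≤ ∫ s in t₀..t₁, deriv (fun s => (y s)⁻¹) s := by
    refine intervalIntegral.integral_mono_ae_restrict ht ha hinvac.intervalIntegrable_deriv ?_
    have hne : ∀ᵐ s ∂(volume : Measure ℝ), s ≠ t₀ := by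
      rw [ae_iff]; simp
    refine (ae_restrict_iff' measurableSet_Icc).2 ?_
    filter_upwards [hge, hne] with s hs hsne hsI
    refine hs ?_
    rw [uIoc_of_le ht]
    exact ⟨lt_of_le_of_ne hsI.1 (Ne.symm hsne), hsI.2⟩
  rw [hFTC] at hmono
  simp only [one_div]
  linarith

/-- **Upper bound from the Riccati inequality**: in the situation of
`inv_add_integral_le_inv_of_deriv_le`, if `∫_{t₀}^{t₁} a > 0` then `y(t₁) ≤ (∫_{t₀}^{t₁} a)⁻¹`
(drop the nonnegative `1/y(t₀)`). This is the bound "`Ψ̄(−c₀/4) ≤ 1/((c₀²/C₀)∫χ e^{−C₀s} ds + 1/Ψ̄(−1/4)) < ∞`,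
depending only on `c₀`" of Lei–Zhang 2011, proof of Lemma 3.2. [cite: LeiZhang2011, proof of Lemma 3.2 (arXiv p. 10)] -/
theorem le_inv_integral_of_deriv_le {y a : ℝ → ℝ} {t₀ t₁ : ℝ} (ht : t₀ ≤ t₁)
    (hy : AbsolutelyContinuousOnInterval y t₀ t₁) (hpos : ∀ t ∈ Icc t₀ t₁, 0 < y t)
    (ha : IntervalIntegrable a volume t₀ t₁)
    (hderiv : ∀ᵐ t, t ∈ Icc t₀ t₁ → deriv y t ≤ -(a t * y t ^ 2))
    (hA : 0 < ∫ s in t₀..t₁, a s) :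
    y t₁ ≤ (∫ s in t₀..t₁, a s)⁻¹ := by
  have h := inv_add_integral_le_inv_of_deriv_le ht hy hpos ha hderiv
  have hy0 : 0 < y t₀ := hpos t₀ ⟨le_rfl, ht⟩
  have hy1 : 0 < y t₁ := hpos t₁ ⟨ht, le_rfl⟩
  have h1 : ∫ s in t₀..t₁, a s ≤ 1 / y t₁ := by
    have : 0 ≤ 1 / y t₀ := by positivity
    linarith
  rw [one_div] at h1
  -- `A ≤ (y t₁)⁻¹` with `A > 0` gives `y t₁ ≤ A⁻¹`
  have h2 := inv_anti₀ hA h1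
  rwa [inv_inv] at h2

end Literature.Analysis.ODE
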